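import Summits.Langlands.Langlands.Theorems.PhantomRMYoshidaResiduallyYoshidaLiftingDefs

/-!
# `ResiduallyYoshidaLifting` (stmt-Langlands-13639) — Negative knowledge / structural lemmas hidden in `Sh`, III:
# Lagrangian duality (T12⁺)

From the standing crux disprover (cdisprove gen 5, 2026-08-16; `Cruxes/ResiduallyYoshidaLifting/Disproof.lean`
§7).  Completes the Lagrangian branch of the symplectic plane dichotomy (`ShSymplecticPlaneDichotomy`):

* `lagrangian_dual`: for a non-degenerate form on a 4-space and a Lagrangian plane `W` (`W^⊥ = W`),
  `w ↦ B(w, ·)` is a linear isomorphism `W ≃ (V/W)^∨`, intertwining a similitude `T` stabilising `W` with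
  `ν · (T̄⁻¹)^∨` — `V/W ≅ W^∨ ⊗ ν`;
* `J₂_mul_mul_J₂inv_eq_adjugate_transpose`, `J₂_conj_eq_det_smul_inv_transpose`: `J₂ A J₂⁻¹ = adj(A)ᵀ =
  det(A)·A⁻ᵀ`, i.e. `σ ≅ σ^∨ ⊗ det σ` for the standard representation of `GL₂`.

Together: a Lagrangian invariant plane of type `σ̄` in a symplectic representation with multiplier `ν̄ = det σ̄`
has quotient `≅ σ̄^∨ ⊗ ν̄ ≅ σ̄` — excluded on the crux's residual type by non-conjugacy, whence
"reducible = split".  Helper lemmas only (no positive route-item conclusion). [folklore]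
-/

noncomputable section

set_option linter.dupNamespace false

namespace Summit.Langlands.Langlands.Theorems.ResiduallyYoshidaLifting.Negative

/-! #### T12⁺ — the Lagrangian case in full: `K⁴/W ≅ W^∨ ⊗ ν`, and `σ ≅ σ^∨ ⊗ det σ` on `GL₂` -/

section LagrangianDuality

open Module Submodule Matrix

/-- `J₂ A J₂⁻¹ = adj(A)ᵀ = det(A) · A⁻ᵀ`: the standard representation of `GL₂` satisfies
`σ ≅ σ^∨ ⊗ det σ` (for the crux's constituents: `σ̄^∨ ⊗ ε̄⁻¹ ≅ σ̄`). [folklore] -/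
theorem J₂_mul_mul_J₂inv_eq_adjugate_transpose {R : Type*} [CommRing R] (A : Matrix (Fin 2) (Fin 2) R) :
    !![(0 : R), 1; -1, 0] * A * !![(0 : R), -1; 1, 0] = A.adjugateᵀ := by
  rw [adjugate_fin_two]
  ext i j
  fin_cases i <;> fin_cases j <;> simp [Matrix.mul_apply, Fin.sum_univ_two, Matrix.vecMul, dotProduct]

/-- `J₂ · J₂' = 1` with `J₂' = -J₂`. [folklore] -/
theorem J₂_mul_J₂' {R : Type*} [CommRing R] :
    !![(0 : R), 1; -1, 0] * !![(0 : R), -1; 1, 0] = 1 := by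
  ext i j; fin_cases i <;> fin_cases j <;> simp

/-- For invertible `A`: `J₂ A J₂⁻¹ = det(A) · (A⁻¹)ᵀ`. [folklore] -/
theorem J₂_conj_eq_det_smul_inv_transpose {K : Type*} [Field K] (A : Matrix (Fin 2) (Fin 2) K)
    (hA : A.det ≠ 0) :
    !![(0 : K), 1; -1, 0] * A * !![(0 : K), -1; 1, 0] = A.det • A⁻¹ᵀ := by
  rw [J₂_mul_mul_J₂inv_eq_adjugate_transpose, Matrix.inv_def, transpose_smul, smul_smul,
    mul_comm, Ring.inverse_mul_cancel _ (isUnit_iff_ne_zero.2 hA), one_smul]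


variable {k V : Type*} [Field k] [AddCommGroup V] [Module k V] [FiniteDimensional k V]

/-- **Lagrangian duality.**  For a non-degenerate form `B` on a 4-space and a LAGRANGIAN plane `W`
(`W^⊥ = W`), `w ↦ B(w, ·)` is a linear ISOMORPHISM `W ≃ (V/W)^∨`; if moreover `T` is a similitude
(`B(Tx, Ty) = ν B(x, y)`) stabilising `W`, the isomorphism intertwines `T|_W` with `ν · (T̄⁻¹)^∨` —
`V/W ≅ W^∨ ⊗ ν` equivariantly.  (The second half is the displayed formula `hequiv`.) [folklore] -/
theorem lagrangian_dual {B : LinearMap.BilinForm k V} (hBnd : B.Nondegenerate) (h4 : finrank k V = 4)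
    {W : Submodule k V} (hW : finrank k W = 2) (hlag : B.orthogonal W = W) :
    ∃ φ : W ≃ₗ[k] Module.Dual k (V ⧸ W),
      (∀ (w : W) (v : V), φ w (W.mkQ v) = B w v) ∧
      ∀ (T : V →ₗ[k] V) (ν : k), (∀ x y, B (T x) (T y) = ν * B x y) →
        ∀ (w : W) (v : V), (T w : V) ∈ W → φ w (W.mkQ v) * ν = B (T w) (T v) := by
  have hvan : ∀ w ∈ W, ∀ v ∈ W, B w v = 0 := fun w hw v hv => by
    have hv' : v ∈ B.orthogonal W := hlag.symm ▸ hv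
    exact (LinearMap.BilinForm.mem_orthogonal_iff.1 hv') w hw
  -- `w ↦ B w` lands in the annihilator of `W`
  let ψ : W →ₗ[k] W.dualAnnihilator :=
    (B.domRestrict W).codRestrict W.dualAnnihilator fun w =>
      (Submodule.mem_dualAnnihilator _).2 fun v hv => hvan w w.2 v hv
  have hψ : ∀ (w : W) (v : V), (ψ w : Module.Dual k V) v = B w v := fun w v => rfl
  have hinj : Function.Injective ψ := by
    intro w₁ w₂ h
    apply Subtype.ext
    have h' : ∀ v, B (w₁ : V) v = B (w₂ : V) v := fun v => by
      have := congrArg (fun f : W.dualAnnihilator => (f : Module.Dual k V) v) h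
      simpa [hψ] using this
    have h0 : ∀ v, B ((w₁ : V) - w₂) v = 0 := fun v => by simp [h' v]
    exact sub_eq_zero.1 (hBnd.1 _ h0)
  have hrank : finrank k W = finrank k W.dualAnnihilator := by
    have := Subspace.finrank_add_finrank_dualAnnihilator_eq W
    omega
  let e₁ := LinearEquiv.ofInjectiveOfFinrankEq (V := ↥W) (V' := ↥W.dualAnnihilator) ψ hinj hrank
  let e₂ := (dualQuotEquivDualAnnihilator W).symm
  let φ := e₁.trans e₂
  have hφ : ∀ (w : W) (v : V), φ w (W.mkQ v) = B w v := fun w v => by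
    simp only [φ, e₁, e₂, LinearEquiv.trans_apply, Submodule.mkQ_apply]
    rw [Submodule.dualQuotEquivDualAnnihilator_symm_apply_mk]
    rfl
  refine ⟨φ, hφ, fun T ν hT w v _ => ?_⟩
  rw [hφ, mul_comm, ← hT]


end LagrangianDuality

end Summit.Langlands.Langlands.Theorems.ResiduallyYoshidaLifting.Negative

end
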